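import Summits.QuantumFields.BalabanUV.T4Continuum.Support.VariationalColourPoincareLocal

/-!
# T⁴ programme, spine node NE2 (U1a), lane P2 — SUPPLIER ITEM (O8) «V-COL-P», PART 2: PHYSICAL UNITS — the `hPc` ∕ `hPf` sockets of the colour
# canonical pair (`VariationalColourScalarPair.colour_pair_bracket`, p215316) DISCHARGED frame-free, `C_P = 136`
# (the colour re-run of leaf-01-g4's `VariationalCovariantPoincareLocal` §4 (p215015))

NE2 formalisation swarm `b2b-balaban-t4-ne2-formalise-*`, leaf prover 02 (gen 4).  Part 1 (`VariationalColourPoincareLocal`): the lattice-unit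
coercivities `nsqv f ≤ 8·n^d·Σ_z‖Qcv T f z‖² + 4·n²·Σ_μ dirUv R f μ` frame-free (`…_of_blockOf`) and relative (`…_rel`).  Here, in the colour letters
`Scv ∕ Sfv ∕ qWv ∕ qVv ∕ Qkv ∕ Q1v` (p215316) and with FED⁺-colour `VariationalColourFederbush.sum_dirUv_Qcv_le` (p214930) BY NAME:
 * **`qWv_le_coarse_local`**: `qWv f ≤ 136·(Scv f + nsqv (Qkv T f))` under UNITARY `T`, the in-block defect `‖Rc(x,μ)∘T(x+e_μ)⋆∘T(x) − 1‖ ≤ w`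
   (bonds with both ends in one block) and `2d·(n·w)² ≤ ½`; **`qWv_le_coarse_rel`** (reference `T₀`, relative operator `γ`, `2d(n·w₀)² + 4γ² ≤ ½`);
 * `qVv_le_composite_of_poincare` (the two lattice-unit coercivities as HYPOTHESES + FED⁺-colour, mismatch absorption `64d·(n·m)² ≤ ½`) ⟹
   **`qVv_le_composite_local`** (one-step local P⁺ at blocks of side `L` for `(R′, T′)` + level-`n` local P⁺) and **`qVv_le_composite_rel`**:
   `qVv f′ ≤ 136·(Sfv f′ + nsqv (Qkv T (Q1v T′ f′)))` — the `hPf` socket; SAME constants as the scalar file, NO frames, NO global small field.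

HONEST FRAMING (T4-DAG p. 1).  Model level (operators DATA, c5); [folklore] arithmetic over part 1 and FED⁺-colour; nothing printed is a
hypothesis; no `def`; no `sorry`; axioms standard.  NE2 NOT proved; spine PROVED 0∕9; rung (B)+1 finite T⁴ — NOT infinite volume, NOT a mass gap,
NOT Clay.  HONEST DEPENDENCY (cell, verbatim): continuum YM on T⁴ ⇐ BetaPertH ∧ nine spine estimates (0/9 proved); BetaPertH ⇐ (D1) ∧ (D4) ∧
CAP+tail; G-an2-4 gates asym, D1 and NE2/3/4.
-/

noncomputable section

namespace Summit.QuantumFields.BalabanUV.T4Continuum.VariationalColourPoincarePhys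

open Finset
open Literature.MathematicalPhysics.QuantumFieldTheory.Balaban1983to89
open Literature.MathematicalPhysics.QuantumFieldTheory.Balaban1983to89.B5Prop11Plancherel (Tor fine unitVec)
open Literature.MathematicalPhysics.QuantumFieldTheory.Balaban1983to89.B5Block118 (bpt)
open Literature.MathematicalPhysics.QuantumFieldTheory.Balaban1983to89.B5Blocks16 (blockOf)
open Summit.QuantumFields.BalabanUV.T4Continuum.VariationalColourFederbush (cDv dirUv Qcv misv dirUv_nonneg sum_dirUv_Qcv_le norm_le_one_of_mem_unitary)
open Summit.QuantumFields.BalabanUV.T4Continuum.VariationalColourUpperBound (nsqv nsqv_nonneg)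
open Summit.QuantumFields.BalabanUV.T4Continuum.VariationalColourScalarPair (Scv Sfv qWv qVv Qkv Q1v Scv_nonneg Sfv_nonneg)
open Summit.QuantumFields.BalabanUV.T4Continuum.VariationalColourPoincareLocal (nsqv_le_colour_poincare_of_blockOf nsqv_le_colour_poincare_rel)

variable {d : ℕ} {E : Type*} [NormedAddCommGroup E] [InnerProductSpace ℂ E] [CompleteSpace E] [FiniteDimensional ℂ E]
variable (n L : ℕ) [NeZero n] [NeZero L] (M : Fin d → ℕ) [hM : ∀ μ, NeZero (M μ)]

/-! ## §1 P⁺ at level `n`, frame-free and relative -/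

omit [NeZero L] in
/-- **P⁺-colour at level `n`, frame-free**: `qWv f ≤ 8·nsqv (Q_T f) + 4·Scv f ≤ 136·(Scv f + nsqv (Q_T f))` under UNITARY site operators, the
in-block defect `w` and `2d·(n·w)² ≤ ½`. [folklore] -/
theorem qWv_le_coarse_local {Rc : Tor (fine n M) → Fin d → (E →L[ℂ] E)} {T : Tor (fine n M) → (E →L[ℂ] E)}
    (hT : ∀ x, T x ∈ unitary (E →L[ℂ] E)) {w : ℝ}
    (hw : ∀ (x : Tor (fine n M)) (μ : Fin d), blockOf n M (x + unitVec (fine n M) μ) = blockOf n M x →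
      ‖Rc x μ * star (T (x + unitVec (fine n M) μ)) * T x - 1‖ ≤ w)
    (hsmall : 2 * (d : ℝ) * ((n : ℝ) * w) ^ 2 ≤ 1 / 2) (f : Tor (fine n M) → E) :
    qWv n M f ≤ 136 * (Scv n M Rc f + nsqv (Qkv n M T f)) := by
  have hn : (0 : ℝ) < (n : ℝ) ^ d := by have := NeZero.ne n; positivity
  set Z : ℝ := nsqv (Qkv n M T f) with hZ
  set D : ℝ := ∑ μ, dirUv (fine n M) Rc f μ with hD
  have hP : nsqv f ≤ 8 * (n : ℝ) ^ d * Z + 4 * (n : ℝ) ^ 2 * D :=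
    nsqv_le_colour_poincare_of_blockOf n M (R := Rc) (T := T) hT hw hsmall f
  have hD0 : 0 ≤ D := sum_nonneg fun μ _ => dirUv_nonneg _ _ _ _
  have hZ0 : 0 ≤ Z := nsqv_nonneg _
  have hSc : Scv n M Rc f = (n : ℝ) ^ 2 / (n : ℝ) ^ d * D := rfl
  have h1 : qWv n M f ≤ 8 * Z + 4 * Scv n M Rc f := by
    unfold qWv
    rw [hSc]
    have e : ((n : ℝ) ^ d)⁻¹ * (8 * (n : ℝ) ^ d * Z + 4 * (n : ℝ) ^ 2 * D) = 8 * Z + 4 * ((n : ℝ) ^ 2 / (n : ℝ) ^ d * D) := by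
      field_simp
    rw [← e]
    exact mul_le_mul_of_nonneg_left hP (by positivity)
  have hSc0 : 0 ≤ Scv n M Rc f := Scv_nonneg n M Rc f
  linarith

omit [NeZero L] in
/-- **P⁺-colour at level `n`, relative form** (UNITARY reference operators `T₀`, relative operator `γ`): `qWv f ≤ 136·(Scv f + nsqv (Q_T f))` under
`2d·(n·w₀)² + 4γ² ≤ ½`. [folklore] -/
theorem qWv_le_coarse_rel {Rc : Tor (fine n M) → Fin d → (E →L[ℂ] E)} {T T₀ : Tor (fine n M) → (E →L[ℂ] E)}
    (hT₀ : ∀ x, T₀ x ∈ unitary (E →L[ℂ] E)) {w₀ γ : ℝ}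
    (hw₀ : ∀ (x : Tor (fine n M)) (μ : Fin d), blockOf n M (x + unitVec (fine n M) μ) = blockOf n M x →
      ‖Rc x μ * star (T₀ (x + unitVec (fine n M) μ)) * T₀ x - 1‖ ≤ w₀)
    (hrel : ∀ x, ‖T x * star (T₀ x) - 1‖ ≤ γ)
    (hsmall : 2 * (d : ℝ) * ((n : ℝ) * w₀) ^ 2 + 4 * γ ^ 2 ≤ 1 / 2) (f : Tor (fine n M) → E) :
    qWv n M f ≤ 136 * (Scv n M Rc f + nsqv (Qkv n M T f)) := by
  have hn : (0 : ℝ) < (n : ℝ) ^ d := by have := NeZero.ne n; positivity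
  set Z : ℝ := nsqv (Qkv n M T f) with hZ
  set D : ℝ := ∑ μ, dirUv (fine n M) Rc f μ with hD
  have hP : nsqv f ≤ 8 * (n : ℝ) ^ d * Z + 4 * (n : ℝ) ^ 2 * D :=
    nsqv_le_colour_poincare_rel n M (R := Rc) (T := T) hT₀ hw₀ hrel hsmall f
  have hD0 : 0 ≤ D := sum_nonneg fun μ _ => dirUv_nonneg _ _ _ _
  have hZ0 : 0 ≤ Z := nsqv_nonneg _
  have hSc : Scv n M Rc f = (n : ℝ) ^ 2 / (n : ℝ) ^ d * D := rfl
  have h1 : qWv n M f ≤ 8 * Z + 4 * Scv n M Rc f := by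
    unfold qWv
    rw [hSc]
    have e : ((n : ℝ) ^ d)⁻¹ * (8 * (n : ℝ) ^ d * Z + 4 * (n : ℝ) ^ 2 * D) = 8 * Z + 4 * ((n : ℝ) ^ 2 / (n : ℝ) ^ d * D) := by
      field_simp
    rw [← e]
    exact mul_le_mul_of_nonneg_left hP (by positivity)
  have hSc0 : 0 ≤ Scv n M Rc f := Scv_nonneg n M Rc f
  linarith

/-! ## §2 P⁺ for the composite constraint at level `nL` -/

omit [CompleteSpace E] [FiniteDimensional ℂ E] in
/-- **P⁺-colour for the COMPOSITE constraint at level `nL` from the two lattice-unit coercivities as HYPOTHESES** + FED⁺-colour (`sum_dirUv_Qcv_le`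
BY NAME, mismatch `m`): `qVv f′ ≤ 136·(Sfv f′ + nsqv (Q_T (Q_{T′} f′)))` provided `64d·(n·m)² ≤ ½`. [folklore] -/
theorem qVv_le_composite_of_poincare {Rc : Tor (fine n M) → Fin d → (E →L[ℂ] E)} {R' : Tor (fine L (fine n M)) → Fin d → (E →L[ℂ] E)}
    {T : Tor (fine n M) → (E →L[ℂ] E)} {T' : Tor (fine L (fine n M)) → (E →L[ℂ] E)}
    (hPn : ∀ g : Tor (fine n M) → E, nsqv g ≤ 8 * (n : ℝ) ^ d * ∑ z, ‖Qcv n M T g z‖ ^ 2 + 4 * (n : ℝ) ^ 2 * ∑ μ, dirUv (fine n M) Rc g μ)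
    (hPL : ∀ g' : Tor (fine L (fine n M)) → E,
      nsqv g' ≤ 8 * (L : ℝ) ^ d * ∑ y, ‖Qcv L (fine n M) T' g' y‖ ^ 2 + 4 * (L : ℝ) ^ 2 * ∑ μ, dirUv (fine L (fine n M)) R' g' μ)
    (hR' : ∀ x μ, ‖R' x μ‖ ≤ 1) (hT' : ∀ x, ‖T' x‖ ≤ 1) {m : ℝ} (hm : 0 ≤ m)
    (hmis : ∀ y μ j, ‖misv L (fine n M) Rc R' T' y μ j‖ ≤ m) (habsorb : 64 * (d : ℝ) * ((n : ℝ) * m) ^ 2 ≤ 1 / 2)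
    (f' : Tor (fine L (fine n M)) → E) :
    qVv n L M f' ≤ 136 * (Sfv n L M R' f' + nsqv (Qkv n M T (Q1v n L M T' f'))) := by
  have hn1 : (1 : ℝ) ≤ n := by exact_mod_cast Nat.one_le_iff_ne_zero.mpr (NeZero.ne n)
  have hn0 : (0 : ℝ) < n := by exact_mod_cast Nat.pos_of_ne_zero (NeZero.ne n)
  have hL0 : (0 : ℝ) < L := by exact_mod_cast Nat.pos_of_ne_zero (NeZero.ne L)
  have hLd : (0 : ℝ) < (L : ℝ) ^ d := pow_pos hL0 d
  have hnLd : (0 : ℝ) < ((n : ℝ) * L) ^ d := pow_pos (mul_pos hn0 hL0) d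
  have hd : (0 : ℝ) ≤ d := Nat.cast_nonneg d
  set lam : Tor (fine n M) → E := Q1v n L M T' f' with hlam
  set Y : ℝ := nsqv f' with hY
  set DX : ℝ := ∑ μ, dirUv (fine L (fine n M)) R' f' μ with hDX
  set P : ℝ := nsqv lam with hPdef
  set Z : ℝ := nsqv (Qkv n M T lam) with hZ
  set E' : ℝ := ∑ μ, dirUv (fine n M) Rc lam μ with hE
  have hY0 : 0 ≤ Y := nsqv_nonneg _
  have hDX0 : 0 ≤ DX := sum_nonneg fun μ _ => dirUv_nonneg _ _ _ _
  have hZ0 : 0 ≤ Z := nsqv_nonneg _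
  have hE0 : 0 ≤ E' := sum_nonneg fun μ _ => dirUv_nonneg _ _ _ _
  have s1 : Y ≤ 8 * (L : ℝ) ^ d * P + 4 * (L : ℝ) ^ 2 * DX := hPL f'
  have s2 : P ≤ 8 * (n : ℝ) ^ d * Z + 4 * (n : ℝ) ^ 2 * E' := hPn lam
  -- FED⁺-colour bounds the coarse Dirichlet sum of the average
  have s3 : (L : ℝ) ^ d * E' ≤ 2 * (L : ℝ) ^ 2 * DX + 2 * d * m ^ 2 * Y := by
    have h : E' ≤ (Real.sqrt ((L : ℝ) ^ 2 * DX / (L : ℝ) ^ d) + Real.sqrt d * (m * Real.sqrt (Y / (L : ℝ) ^ d))) ^ 2 :=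
      sum_dirUv_Qcv_le L (fine n M) Rc R' T' hR' hT' hm hmis f'
    have ha : 0 ≤ (L : ℝ) ^ 2 * DX / (L : ℝ) ^ d := div_nonneg (mul_nonneg (sq_nonneg _) hDX0) hLd.le
    have hb : 0 ≤ Y / (L : ℝ) ^ d := div_nonneg hY0 hLd.le
    set A : ℝ := Real.sqrt ((L : ℝ) ^ 2 * DX / (L : ℝ) ^ d) with hA
    set B : ℝ := Real.sqrt d * (m * Real.sqrt (Y / (L : ℝ) ^ d)) with hB
    have hA2 : A ^ 2 = (L : ℝ) ^ 2 * DX / (L : ℝ) ^ d := Real.sq_sqrt ha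
    have hB2 : B ^ 2 = d * (m ^ 2 * (Y / (L : ℝ) ^ d)) := by
      rw [hB, mul_pow, mul_pow, Real.sq_sqrt hd, Real.sq_sqrt hb]
    have h3 : E' ≤ 2 * ((L : ℝ) ^ 2 * DX / (L : ℝ) ^ d) + 2 * (d * (m ^ 2 * (Y / (L : ℝ) ^ d))) := by
      rw [← hA2, ← hB2]
      have hab : (A + B) ^ 2 ≤ 2 * A ^ 2 + 2 * B ^ 2 := by nlinarith [sq_nonneg (A - B)]
      exact h.trans hab
    have h4 := mul_le_mul_of_nonneg_left h3 hLd.le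
    have e : (L : ℝ) ^ d * (2 * ((L : ℝ) ^ 2 * DX / (L : ℝ) ^ d) + 2 * (d * (m ^ 2 * (Y / (L : ℝ) ^ d))))
        = 2 * (L : ℝ) ^ 2 * DX + 2 * d * m ^ 2 * Y := by field_simp
    rwa [e] at h4
  have t1 : 8 * (L : ℝ) ^ d * P ≤ 8 * (L : ℝ) ^ d * (8 * (n : ℝ) ^ d * Z + 4 * (n : ℝ) ^ 2 * E') :=
    mul_le_mul_of_nonneg_left s2 (by positivity)
  have t3 : 32 * (n : ℝ) ^ 2 * ((L : ℝ) ^ d * E') ≤ 32 * (n : ℝ) ^ 2 * (2 * (L : ℝ) ^ 2 * DX + 2 * d * m ^ 2 * Y) :=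
    mul_le_mul_of_nonneg_left s3 (by positivity)
  have comb : Y ≤ 64 * ((n : ℝ) ^ d * (L : ℝ) ^ d) * Z + (64 * (n : ℝ) ^ 2 * (L : ℝ) ^ 2 + 4 * (L : ℝ) ^ 2) * DX
      + 64 * (d : ℝ) * ((n : ℝ) * m) ^ 2 * Y := by
    nlinarith [s1, t1, t3]
  have hpow : (n : ℝ) ^ d * (L : ℝ) ^ d = ((n : ℝ) * L) ^ d := by rw [mul_pow]
  rw [hpow] at comb
  have t4 : 64 * (d : ℝ) * ((n : ℝ) * m) ^ 2 * Y ≤ 1 / 2 * Y := mul_le_mul_of_nonneg_right habsorb hY0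
  have hL2 : (L : ℝ) ^ 2 * DX ≤ ((n : ℝ) * L) ^ 2 * DX := by
    refine mul_le_mul_of_nonneg_right ?_ hDX0
    rw [mul_pow]
    calc (L : ℝ) ^ 2 = 1 * (L : ℝ) ^ 2 := (one_mul _).symm
      _ ≤ (n : ℝ) ^ 2 * (L : ℝ) ^ 2 := mul_le_mul_of_nonneg_right (one_le_pow₀ hn1) (sq_nonneg _)
  have hYb : Y ≤ 128 * ((n : ℝ) * L) ^ d * Z + 136 * (((n : ℝ) * L) ^ 2 * DX) := by
    have e3 : (64 * (n : ℝ) ^ 2 * (L : ℝ) ^ 2 + 4 * (L : ℝ) ^ 2) * DX = 64 * (((n : ℝ) * L) ^ 2 * DX) + 4 * ((L : ℝ) ^ 2 * DX) := by ring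
    rw [e3] at comb
    linarith [comb, t4, hL2]
  have hSf : Sfv n L M R' f' = ((n : ℝ) * L) ^ 2 / ((n : ℝ) * L) ^ d * DX := rfl
  have hqV : qVv n L M f' = (((n : ℝ) * L) ^ d)⁻¹ * Y := rfl
  rw [hqV, hSf]
  have h5 : (((n : ℝ) * L) ^ d)⁻¹ * Y ≤ 128 * Z + 136 * (((n : ℝ) * L) ^ 2 / ((n : ℝ) * L) ^ d * DX) := by
    have e : (((n : ℝ) * L) ^ d)⁻¹ * (128 * ((n : ℝ) * L) ^ d * Z + 136 * (((n : ℝ) * L) ^ 2 * DX))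
        = 128 * Z + 136 * (((n : ℝ) * L) ^ 2 / ((n : ℝ) * L) ^ d * DX) := by
      field_simp
    rw [← e]
    exact mul_le_mul_of_nonneg_left hYb (by positivity)
  have hS0 : 0 ≤ ((n : ℝ) * L) ^ 2 / ((n : ℝ) * L) ^ d * DX := mul_nonneg (div_nonneg (sq_nonneg _) hnLd.le) hDX0
  linarith [h5, hS0, hZ0]

/-- **P⁺-colour for the COMPOSITE constraint at level `nL`, frame-free** = one-step local P⁺ (blocks of side `L`, UNITARY `T′`, in-block defect `w′`)
+ level-`n` local P⁺ (UNITARY `T`, in-block defect `w`) + FED⁺-colour: `qVv f′ ≤ 136·(Sfv f′ + nsqv (Q_T (Q_{T′} f′)))`, provided `2d(n·w)² ≤ ½`,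
`2d(L·w′)² ≤ ½` and `64d·(n·m)² ≤ ½` — the `hPf` socket of `colour_pair_bracket`. [folklore] -/
theorem qVv_le_composite_local {Rc : Tor (fine n M) → Fin d → (E →L[ℂ] E)} {R' : Tor (fine L (fine n M)) → Fin d → (E →L[ℂ] E)}
    {T : Tor (fine n M) → (E →L[ℂ] E)} {T' : Tor (fine L (fine n M)) → (E →L[ℂ] E)} (hT : ∀ x, T x ∈ unitary (E →L[ℂ] E)) {w : ℝ}
    (hw : ∀ (x : Tor (fine n M)) (μ : Fin d), blockOf n M (x + unitVec (fine n M) μ) = blockOf n M x →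
      ‖Rc x μ * star (T (x + unitVec (fine n M) μ)) * T x - 1‖ ≤ w)
    (hsmall : 2 * (d : ℝ) * ((n : ℝ) * w) ^ 2 ≤ 1 / 2)
    (hT' : ∀ x, T' x ∈ unitary (E →L[ℂ] E)) {w' : ℝ}
    (hw' : ∀ (x : Tor (fine L (fine n M))) (μ : Fin d), blockOf L (fine n M) (x + unitVec (fine L (fine n M)) μ) = blockOf L (fine n M) x →
      ‖R' x μ * star (T' (x + unitVec (fine L (fine n M)) μ)) * T' x - 1‖ ≤ w')
    (hsmall' : 2 * (d : ℝ) * ((L : ℝ) * w') ^ 2 ≤ 1 / 2)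
    (hR' : ∀ x μ, ‖R' x μ‖ ≤ 1) {m : ℝ} (hm : 0 ≤ m)
    (hmis : ∀ y μ j, ‖misv L (fine n M) Rc R' T' y μ j‖ ≤ m) (habsorb : 64 * (d : ℝ) * ((n : ℝ) * m) ^ 2 ≤ 1 / 2)
    (f' : Tor (fine L (fine n M)) → E) :
    qVv n L M f' ≤ 136 * (Sfv n L M R' f' + nsqv (Qkv n M T (Q1v n L M T' f'))) :=
  qVv_le_composite_of_poincare n L M (nsqv_le_colour_poincare_of_blockOf n M hT hw hsmall)
    (nsqv_le_colour_poincare_of_blockOf L (fine n M) hT' hw' hsmall') hR' (fun x => norm_le_one_of_mem_unitary (hT' x)) hm hmis habsorb f'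

/-- **P⁺-colour for the COMPOSITE constraint, relative form at the coarse level**: the level-`n` site operators `T` are read against UNITARY reference
operators `T₀` (in-block defect `w₀`, relative operator `γ`, `2d(n·w₀)² + 4γ² ≤ ½`); the one-step level is frame-free (UNITARY `T′`, `w′`). [folklore] -/
theorem qVv_le_composite_rel {Rc : Tor (fine n M) → Fin d → (E →L[ℂ] E)} {R' : Tor (fine L (fine n M)) → Fin d → (E →L[ℂ] E)}
    {T T₀ : Tor (fine n M) → (E →L[ℂ] E)} {T' : Tor (fine L (fine n M)) → (E →L[ℂ] E)} (hT₀ : ∀ x, T₀ x ∈ unitary (E →L[ℂ] E)) {w₀ γ : ℝ}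
    (hw₀ : ∀ (x : Tor (fine n M)) (μ : Fin d), blockOf n M (x + unitVec (fine n M) μ) = blockOf n M x →
      ‖Rc x μ * star (T₀ (x + unitVec (fine n M) μ)) * T₀ x - 1‖ ≤ w₀)
    (hrel : ∀ x, ‖T x * star (T₀ x) - 1‖ ≤ γ)
    (hsmall : 2 * (d : ℝ) * ((n : ℝ) * w₀) ^ 2 + 4 * γ ^ 2 ≤ 1 / 2)
    (hT' : ∀ x, T' x ∈ unitary (E →L[ℂ] E)) {w' : ℝ}
    (hw' : ∀ (x : Tor (fine L (fine n M))) (μ : Fin d), blockOf L (fine n M) (x + unitVec (fine L (fine n M)) μ) = blockOf L (fine n M) x →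
      ‖R' x μ * star (T' (x + unitVec (fine L (fine n M)) μ)) * T' x - 1‖ ≤ w')
    (hsmall' : 2 * (d : ℝ) * ((L : ℝ) * w') ^ 2 ≤ 1 / 2)
    (hR' : ∀ x μ, ‖R' x μ‖ ≤ 1) {m : ℝ} (hm : 0 ≤ m)
    (hmis : ∀ y μ j, ‖misv L (fine n M) Rc R' T' y μ j‖ ≤ m) (habsorb : 64 * (d : ℝ) * ((n : ℝ) * m) ^ 2 ≤ 1 / 2)
    (f' : Tor (fine L (fine n M)) → E) :
    qVv n L M f' ≤ 136 * (Sfv n L M R' f' + nsqv (Qkv n M T (Q1v n L M T' f'))) :=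
  qVv_le_composite_of_poincare n L M (nsqv_le_colour_poincare_rel n M hT₀ hw₀ hrel hsmall)
    (nsqv_le_colour_poincare_of_blockOf L (fine n M) hT' hw' hsmall') hR' (fun x => norm_le_one_of_mem_unitary (hT' x)) hm hmis habsorb f'

end Summit.QuantumFields.BalabanUV.T4Continuum.VariationalColourPoincarePhys

end
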